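import Literature.Topology.FourManifolds.FishtailEndHyp
import HarnessLib

/-!
# Gompf's Theorem 2.1 (AGT 2010), the framed twist: proof (`gompf2010_framedTwist_holds`)

The discharge `gompf2010_framedTwist_holds` of the named fact
`Literature.Topology.FourManifolds.gompf2010_framedTwist` (`GompfTheorem43.lean`; this file is a
sibling of `GompfTheorem43Proofs.lean`, which cannot import the fishtail files without an import
cycle): for `A` in
Gompf's standard form with `det (A - 1) = 1`, every smooth path `γ` from `1` to `A` and every `k`,
the surgered mapping tori `X^σ_{A,γ}`, `X^σ_{ΔᵏA, Δᵏ·γ}` and `X^σ_{AΔᵏ, γ·Δᵏ}` are diffeomorphic.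

The proof follows Gompf (proof of Thm 2.1 with Lemma 2.2 and §4 ¶3): after the reductions of
`GompfFramedTwistOfTubeModel.lean` (straightening of the path, the tube-shear model, one twist at a
time) it remains to produce, in the tube-shear model `X^σ` at every tube radius `r`, a diffeomorphism
of `Y = X^σ ∖ Σ` supported near Gompf's box-with-handle `N ∪ D` which is the sliver twist of the far
Dehn twist `δ` near the sliver `Σ`; this is Gompf's fishtail diffeomorphism — the base turn of the
fishtail neighbourhood `Φ = N ∪ (2-handle on the vanishing cycle)` conjugated by the explicit end map
`ι` of the concrete fishtail data `FP.fishJ ε`, `ε = min (r/2) (1/2)` (`FishtailEmbedding.lean`,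
`FishtailEndHyp.lean` and the files they import).

Everything is proved; no named facts.

## References

* R. E. Gompf, *More Cappell–Shaneson spheres are standard*, Algebr. Geom. Topol. 10 (2010)
  1665–1681, Thm 2.1, Lemma 2.2, §4 ¶3. [GompfAGT2010]
-/

noncomputable section

open scoped Real

namespace Literature.Topology.FourManifolds

/-- **Gompf's Theorem (AGT 2010, Thm 2.1 with §4 ¶3), the framed twist**: for `A` in Gompf's
standard form with `det (A - 1) = 1` (so that `X_A^σ` is a homotopy sphere), every smooth path `γ`
and every `k`, the surgered mapping tori of `A`, `Δᵏ A` and `A Δᵏ` (with the transported framing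
paths) are diffeomorphic. Proof: the reduction `gompf2010_framedTwist_of_fishtailData` to the
concrete fishtail end data `fishJ ε` at surgery radius `ε = min (r/2) (1/2)` for every tube radius
`r`, whose model, local-diffeomorphism and end hypotheses are `FP.modelHyp`, `FP.locHyp` and
`FP.endHyp`. [cite: GompfAGT2010, Thm 2.1, Lemma 2.2 and §4 ¶3] -/
theorem gompf2010_framedTwist_holds : gompf2010_framedTwist := by
  refine gompf2010_framedTwist_of_fishtailData fun r hr hr1 ↦ ?_
  have hε : 0 < min (r / 2) (1 / 2) := lt_min (by linarith) (by norm_num)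
  have hε2 : min (r / 2) (1 / 2) ≤ 1 / 2 := min_le_right _ _
  have hrπ : r ≤ π := by linarith [Real.pi_gt_three]
  have hεr : min (r / 2) (1 / 2) ≤ r := (min_le_left _ _).trans (by linarith)
  exact ⟨fishJ (min (r / 2) (1 / 2)) hε hε2, FP.modelHyp hε hε2, FP.delC (min (r / 2) (1 / 2)) hε hε2, FP.locHyp hε hε2,
    FP.E1_pos, FP.E1_le_half, FP.eaP, FP.ebP, FP.etaP, FP.etaP_pos, FP.etaP_le.trans (by norm_num), hrπ,
    FP.endHyp hε hε2 (FP.modelHyp hε hε2) hrπ hεr, min_le_left _ _⟩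

end Literature.Topology.FourManifolds
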